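import Literature.NumberTheory.EllipticCurves.CharIdealDualInflationStepProofs
import Literature.NumberTheory.GaloisRepresentations.GaloisCohomologyInfResProofs
import Literature.NumberTheory.GaloisRepresentations.DiscreteCochains
import Literature.NumberTheory.GaloisRepresentations.ContinuousCorestriction
import Literature.NumberTheory.EllipticCurves.IwasawaEulerCharDualityProofs
import HarnessLib

/-!
# The inflation–restriction frame for characteristic ideals of duals of `H¹` over `Λ = ℤ_p⟦T⟧`
# (Greenberg–Vatsal 2000 Prop. 2.4, the shape): `H¹(Γ/N, M^N)^∨` finite and `P ∈ Ch` of the dual of a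
# submodule of `H¹(N, M)` containing the restrictions ⟹ `H¹(Γ, M)^∨` f.g. torsion with `P ∈ Ch`

Generic (THEOREMS ONLY; no definition, no named fact, no `sorry`). Cell `bsd-stepL`, K2 support 20495
`JSWSigmaLocalCharIdeal`, module L5 (the FINITELY DECOMPOSED places) of the discharge plan; seat
`bsd-stepL-imc-p1` g13. For a topological group `Γ`, a normal subgroup `N ⊴ Γ`, and a DISCRETE
`Λ`-linear continuous representation `ρ` of `Γ` on `M` (in the application: `Γ = Γ_{K_w}`, `N = I_w`,
`M = T_pE ⊗ Λ^*(Ψ⁻¹)` restricted to the decomposition group at a finitely decomposed `w ∤ p`):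

* `inf_one_injective_quotientInvariants`, `exact_inf_res_one_quotientInvariants` — the `Λ`-LINEAR
  inflation `H¹(Γ/N, M^N) → H¹(Γ, M)` (Mathlib functoriality along `Γ → Γ/N` and `M^N ↪ M`, for the
  tree's `ContinuousRep.quotientInvariants`) is injective and `H¹(Γ/N, M^N) → H¹(Γ, M) → H¹(N, M)`
  (`resSubgroup`) is exact — the tree's coefficient-general `ContinuousCohomology.inf_one_injective` ∕
  `exact_inf_res_one` instantiated (as `HochschildSerreLowDegree.infOne_exact_resSubgroup` does over `ℤ`);
* **`moduleFinite_isTorsion_mem_charIdeal_dual_h1_of_infRes`** — if `H¹(Γ/N, M^N)^∨` is FINITE and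
  some `Λ`-submodule `L' ≤ H¹(N, M)` containing all restrictions has finitely generated torsion dual with
  `P ∈ Ch_Λ((L')^∨)`, then `H¹(Γ, M)^∨` is finitely generated torsion and `P ∈ Ch_Λ(H¹(Γ, M)^∨)`
  (`Module.moduleFinite_isTorsion_mem_charIdeal_of_exact_dual_of_finite`). In [GreenbergVatsal2000]
  Prop. 2.4 ∕ [Skinner2016PacificMC] §2.3, `L' = H¹(I_ℓ, 𝓜)^{G_ℓ/I_ℓ}` ("each `H¹(I_ℓ, 𝓜)^{G_{ℚ_ℓ}}` is a
  cotorsion `Λ_𝒪`-module, and the characteristic ideal of its Pontryagin dual is generated by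
  `P_ℓ(Ψ⁻¹ε⁻¹(frob_ℓ))`") and `H¹(G_ℓ/I_ℓ, 𝓜^{I_ℓ})` is finite at a finitely decomposed `ℓ`.

References: [GreenbergVatsal2000] Prop. 2.4; [Skinner2016PacificMC] §2.3 (p. 180); [SerreGaloisCohomology1997]
I §2.6 (b); [NeukirchSchmidtWingberg2008] (1.6.7).
-/

noncomputable section

open scoped Classical

open CategoryTheory Function

universe u

namespace Literature.NumberTheory.EllipticCurves

open Literature.NumberTheory.GaloisRepresentations

variable {p : ℕ} [Fact p.Prime] [TopologicalSpace (IwasawaAlgebra p)]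
variable {Γ : Type u} [Group Γ] [TopologicalSpace Γ] [IsTopologicalGroup Γ] (N : Subgroup Γ) [N.Normal]
variable {M : Type u} [AddCommGroup M] [Module (IwasawaAlgebra p) M] [TopologicalSpace M]
  [DiscreteTopology M] [ContinuousSMul (IwasawaAlgebra p) M]
variable (ρ : ContinuousRep Γ (IwasawaAlgebra p) M)

/-- **Inflation `H¹(Γ/N, M^N) → H¹(Γ, M)` is injective** (`Λ`-linear version, `M` discrete): the
tree's `ContinuousCohomology.inf_one_injective` for the inclusion `M^N ↪ M` of
`ContinuousRep.quotientInvariants`. [cite: SerreGaloisCohomology1997, I §2.6 (b)] -/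
theorem inf_one_injective_quotientInvariants :
    Function.Injective (ContinuousCohomology.map (ContinuousMonoidHom.quotientMk N)
      (X := (ρ.quotientInvariants N).toTopRep) (Y := ρ.toTopRep)
      (TopRep.ofHom ⟨⟨(ρ.invariantsOf N).subtype, continuous_of_discreteTopology⟩, fun _ => rfl⟩) 1).hom :=
  ContinuousCohomology.inf_one_injective (S := N) _ Subtype.val_injective
    fun m hm => ⟨⟨m, fun n => hm n n.2⟩, rfl⟩

/-- **Inflation–restriction `H¹(Γ/N, M^N) → H¹(Γ, M) → H¹(N, M)` is exact** (`Λ`-linear version, `M`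
discrete; `res = resSubgroup`): the tree's `ContinuousCohomology.exact_inf_res_one`.
[cite: SerreGaloisCohomology1997, I §2.6 (b)] [cite: NeukirchSchmidtWingberg2008, (1.6.7)] -/
theorem exact_inf_res_one_quotientInvariants :
    Function.Exact (ContinuousCohomology.map (ContinuousMonoidHom.quotientMk N)
      (X := (ρ.quotientInvariants N).toTopRep) (Y := ρ.toTopRep)
      (TopRep.ofHom ⟨⟨(ρ.invariantsOf N).subtype, continuous_of_discreteTopology⟩, fun _ => rfl⟩) 1).hom
      (resSubgroup ρ.toTopRep N 1).hom :=
  ContinuousCohomology.exact_inf_res_one (S := N) _ (subgroupSubtypeHom N)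
    (Y := subgroupRep ρ.toTopRep N)
    (TopRep.ofHom ⟨ContinuousLinearMap.id (IwasawaAlgebra p) ρ.toTopRep, fun _ => rfl⟩)
    Subtype.val_injective Topology.IsInducing.subtypeVal (fun m hm => ⟨⟨m, fun n => hm n n.2⟩, rfl⟩)
    (fun h => h.2) (fun s hs => ⟨⟨s, hs⟩, rfl⟩) bijective_id fun m => ρ.continuous_apply_left m

/-- **The inflation–restriction frame for `Ch_Λ(H¹(Γ, M)^∨)`** (the shape of [GreenbergVatsal2000]
Prop. 2.4 ∕ [Skinner2016PacificMC] §2.3 at a place `ℓ ≠ p`): let `ρ` be a discrete `Λ`-linear continuous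
representation of `Γ` on `M` and `N ⊴ Γ`. If the Pontryagin dual of `H¹(Γ/N, M^N)` is FINITE, and
`L' ≤ H¹(N, M)` is a `Λ`-submodule containing every restriction `res_N(y)` whose dual is finitely
generated torsion with `P ∈ Ch_Λ((L')^∨)`, then `H¹(Γ, M)^∨` (Mathlib `CharacterModule` of the continuous
`H¹`) is finitely generated and torsion over `Λ`, and `P ∈ Ch_Λ(H¹(Γ, M)^∨)`.
[cite: GreenbergVatsal2000, Prop. 2.4] [cite: Skinner2016PacificMC, §2.3 (p. 180, "each `H¹(I_ℓ, 𝓜)^{G_{ℚ_ℓ}}`, `ℓ ≠ p`, is a cotorsion `Λ_𝒪`-module, and the `Λ_𝒪`-characteristic ideal of its Pontryagin dual is generated by `P_ℓ(Ψ⁻¹ε⁻¹(frob_ℓ))`")] -/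
theorem moduleFinite_isTorsion_mem_charIdeal_dual_h1_of_infRes
    [Finite (CharacterModule (continuousCohomology 1 (ρ.quotientInvariants N).toTopRep))]
    (L' : Submodule (IwasawaAlgebra p) (continuousCohomology 1 (subgroupRep ρ.toTopRep N)))
    (hL' : ∀ y, (resSubgroup ρ.toTopRep N 1).hom y ∈ L')
    [Module.Finite (IwasawaAlgebra p) (CharacterModule L')]
    (htors : Module.IsTorsion (IwasawaAlgebra p) (CharacterModule L'))
    {P : IwasawaAlgebra p}
    (hP : P ∈ Module.charIdeal (IwasawaAlgebra p) (CharacterModule L')) :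
    Module.Finite (IwasawaAlgebra p) (CharacterModule (continuousCohomology 1 ρ.toTopRep)) ∧
      Module.IsTorsion (IwasawaAlgebra p)
        (CharacterModule (continuousCohomology 1 ρ.toTopRep)) ∧
      P ∈ Module.charIdeal (IwasawaAlgebra p)
        (CharacterModule (continuousCohomology 1 ρ.toTopRep)) := by
  set inf := (ContinuousCohomology.map (ContinuousMonoidHom.quotientMk N)
      (X := (ρ.quotientInvariants N).toTopRep) (Y := ρ.toTopRep)
      (TopRep.ofHom ⟨⟨(ρ.invariantsOf N).subtype, continuous_of_discreteTopology⟩, fun _ => rfl⟩) 1)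
    with hinf
  set res := resSubgroup ρ.toTopRep N 1 with hres
  have hi : Function.Injective inf.hom.toLinearMap := inf_one_injective_quotientInvariants N ρ
  have hex : Function.Exact inf.hom.toLinearMap res.hom.toLinearMap :=
    exact_inf_res_one_quotientInvariants N ρ
  -- corestrict `res` to `L'`
  set r : continuousCohomology 1 ρ.toTopRep →ₗ[IwasawaAlgebra p] L' :=
    res.hom.toLinearMap.codRestrict L' hL' with hr
  have hir : Function.Exact inf.hom.toLinearMap r := by
    intro y
    rw [← hex y]
    constructor
    · intro h; exact congrArg Subtype.val h
    · intro h; exact Subtype.ext h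
  exact Module.moduleFinite_isTorsion_mem_charIdeal_of_exact_dual_of_finite
    inf.hom.toLinearMap hi r hir htors hP

/-! ### Appended (imc-p1 g13): the frame with the UNRAMIFIED-KERNEL hypothesis -/

/-- **The frame, unramified-kernel form.** Same as
`moduleFinite_isTorsion_mem_charIdeal_dual_h1_of_infRes`, but with the finiteness hypothesis placed on
`ker(res_N : H¹(Γ, M) → H¹(N, M))` (the "unramified classes", which the tree's `HOneUnramifiedProcyclic`
computes as `M^N/(φ − 1)M^N` for `Γ/N` procyclic on `φ`) instead of on `H¹(Γ/N, M^N)^∨`: inflation is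
injective with image `ker res` (`exact_inf_res_one_quotientInvariants`), so `H¹(Γ/N, M^N) ≅ ker res` is
finite, hence so is its character module (`PontryaginCard.finite_characterModule_of_finite`).
[cite: GreenbergVatsal2000, Prop. 2.4] [cite: SerreLocalFields1979, XIII §1 (`H¹(Ẑ, A) = A/(F − 1)A`)] -/
theorem moduleFinite_isTorsion_mem_charIdeal_dual_h1_of_finite_ker_res
    (hker : Set.Finite {y : continuousCohomology 1 ρ.toTopRep | (resSubgroup ρ.toTopRep N 1).hom y = 0})
    (L' : Submodule (IwasawaAlgebra p) (continuousCohomology 1 (subgroupRep ρ.toTopRep N)))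
    (hL' : ∀ y, (resSubgroup ρ.toTopRep N 1).hom y ∈ L')
    [Module.Finite (IwasawaAlgebra p) (CharacterModule L')]
    (htors : Module.IsTorsion (IwasawaAlgebra p) (CharacterModule L'))
    {P : IwasawaAlgebra p}
    (hP : P ∈ Module.charIdeal (IwasawaAlgebra p) (CharacterModule L')) :
    Module.Finite (IwasawaAlgebra p) (CharacterModule (continuousCohomology 1 ρ.toTopRep)) ∧
      Module.IsTorsion (IwasawaAlgebra p)
        (CharacterModule (continuousCohomology 1 ρ.toTopRep)) ∧
      P ∈ Module.charIdeal (IwasawaAlgebra p)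
        (CharacterModule (continuousCohomology 1 ρ.toTopRep)) := by
  -- `H¹(Γ/N, M^N) ↪ ker res`, hence finite
  set inf := (ContinuousCohomology.map (ContinuousMonoidHom.quotientMk N)
      (X := (ρ.quotientInvariants N).toTopRep) (Y := ρ.toTopRep)
      (TopRep.ofHom ⟨⟨(ρ.invariantsOf N).subtype, continuous_of_discreteTopology⟩, fun _ => rfl⟩) 1)
    with hinf
  have hi : Function.Injective inf.hom := inf_one_injective_quotientInvariants N ρ
  have hex : Function.Exact inf.hom (resSubgroup ρ.toTopRep N 1).hom :=
    exact_inf_res_one_quotientInvariants N ρ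
  haveI := hker.to_subtype
  haveI : Finite (continuousCohomology 1 (ρ.quotientInvariants N).toTopRep) := by
    refine Finite.of_injective (fun x => (⟨inf.hom x, ?_⟩ :
      {y : continuousCohomology 1 ρ.toTopRep | (resSubgroup ρ.toTopRep N 1).hom y = 0})) ?_
    · exact (hex (inf.hom x)).mpr ⟨x, rfl⟩
    · intro x x' h
      exact hi (congrArg Subtype.val h)
  haveI : Finite (CharacterModule (continuousCohomology 1 (ρ.quotientInvariants N).toTopRep)) :=
    PontryaginCard.finite_characterModule_of_finite _
  exact moduleFinite_isTorsion_mem_charIdeal_dual_h1_of_infRes N ρ L' hL' htors hP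

end Literature.NumberTheory.EllipticCurves

end
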